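/-
Copyright (c) 2026. All rights reserved.
Released under Apache 2.0 license as described in the file LICENSE.
Authors: abc-iut cell, wave-4 seat abc-iut-w4-d059 (proof-only; the compactness core of the (I4′)/(AI4″)
branch-pair producers: in a COMPACT group, compatible systems that are translates level by level are
translates, so their stabilisers are conjugate).
-/
import Literature.AnabelianGeometry.SemiGraphs.TemperedBranchPairProfinite
import Mathlib.Algebra.Group.End
import Mathlib.Tactic.Group
import HarnessLib

/-!
# [SemiAnbd] Thm 3.7 (iii) p. 41, Comments (6)(b): "converge, in the profinite topology" — the orbit-closure
# lemma in a compact group (proof-only)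

Mochizuki, *Semi-graphs of anabelioids*, Publ. RIMS **42** (2006), proof of Thm 3.7 (iii) p. 41 with the
author's Comments (2020) (6)(b): the compatible systems of fixed data of the FINITE levels "converge, in the
profinite topology, to some profinite [datum]" and "this implies [cf. Remark 2.2.1] that `H` is contained in
some conjugate in [the profinite completion]" — identifications of stabilisers happen in a COMPACT group,
where compatible choices exist. [cite: MochizukiSemiAnbd2006, Thm 3.7(iii) p.41]

PROOF-ONLY, GENERIC file (abc-iut cell, sub-DAG `plan/L3/SUBDAG-SemiAnbd-Thm54.md`, producer row T54-B,
piece (P-A) of the (AI4″) producer, seat abc-iut-w4-d059): a compact topological group `Q` acting on a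
directed inverse system of levels `X_j` through monoid homomorphisms `Q →* Function.End (X_j)` (e.g.
`q ↦ (vertexMap of the level automorphism)`) with OPEN kernels (finite levels), the transition maps being
equivariant.

* `isClosed_setOf_apply_eq` — transporters `{q | q · x = y}` are closed (indeed clopen);
* `exists_forall_apply_eq_of_forall_exists_mem` — if the compatible systems `s`, `s'` are translates of each
  other AT EVERY LEVEL by elements of a closed subgroup `A`, then `s' = a · s` for ONE `a ∈ A` (Cantor's
  intersection theorem in the compact `Q`); `exists_forall_apply_eq_of_forall_exists` — the case `A = Q`;
* `forall_apply_eq_iff_of_translate` — consequently the full stabiliser of `s'` is the conjugate by `a` of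
  the full stabiliser of `s`, written as a membership equivalence.

No definition; nothing specific to anabelioids or semi-graphs; nothing here takes a side on [IUTchIII]
Cor. 3.12.
-/

namespace Literature.AnabelianGeometry.SemiGraphs

namespace CompactOrbit

universe v u w

variable {Q : Type u} [Group Q] [TopologicalSpace Q] [IsTopologicalGroup Q]
  {J : Type v} [Preorder J] {X : J → Type w} (φ : ∀ j, Q →* Function.End (X j))
  (t : ∀ ⦃i j : J⦄, i ≤ j → X j → X i)

omit [IsTopologicalGroup Q] [Preorder J] in
/-- **Transporters are closed** when the action at each level has an open kernel (the level is reached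
through a discrete quotient): `{q | q · x = y}` is a union of cosets of the open kernel, and so is its
complement. [cite: MochizukiSemiAnbd2006, Thm 3.7(iii) p.41] -/
theorem isClosed_setOf_apply_eq [ContinuousMul Q] (hker : ∀ j, IsOpen ((φ j).ker : Set Q)) (j : J)
    (x y : X j) : IsClosed {q : Q | φ j q x = y} := by
  -- the complement is open: around `q₀ ∉ S`, the coset `q₀ · ker` misses `S`
  rw [← isOpen_compl_iff, isOpen_iff_mem_nhds]
  intro q₀ hq₀
  have hcont : Continuous fun k : Q => q₀ * k := continuous_const.mul continuous_id
  -- the open neighbourhood `{q | q₀⁻¹ q ∈ ker}` of `q₀`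
  have hopen : IsOpen {q : Q | q₀⁻¹ * q ∈ (φ j).ker} :=
    (hker j).preimage (continuous_const.mul continuous_id)
  refine Filter.mem_of_superset (hopen.mem_nhds (by simp [MonoidHom.mem_ker, -map_mul])) ?_
  intro q hq hqS
  apply hq₀
  have hk : φ j (q₀⁻¹ * q) = 1 := hq
  have hφ : φ j q₀ = φ j q := by
    have h1 : q = q₀ * (q₀⁻¹ * q) := (mul_inv_cancel_left q₀ q).symm
    rw [h1, map_mul, hk, mul_one]
  change φ j q₀ x = y
  rw [hφ]; exact hqS

/-- **Levelwise translates are translates (relative to a closed subgroup)**: in a COMPACT group `Q`, if two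
compatible systems `s`, `s'` of a directed inverse system of levels with open-kernel actions and
equivariant transitions satisfy "`s'_j = a_j · s_j` for some `a_j ∈ A`" at every level, `A` a closed
subgroup, then `s' = a · s` for ONE `a ∈ A` — Cantor's intersection theorem for the closed nonempty
decreasing transporters `A ∩ {q | q · s_j = s'_j}`. [cite: MochizukiSemiAnbd2006, Thm 3.7(iii) p.41] -/
theorem exists_forall_apply_eq_of_forall_exists_mem [CompactSpace Q] [IsDirectedOrder J] [Nonempty J]
    (hker : ∀ j, IsOpen ((φ j).ker : Set Q))
    (hequiv : ∀ ⦃i j : J⦄ (h : i ≤ j) (q : Q) (x : X j), t h (φ j q x) = φ i q (t h x))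
    (A : Subgroup Q) (hA : IsClosed (A : Set Q))
    {s s' : ∀ j, X j} (hs : ∀ ⦃i j : J⦄ (h : i ≤ j), t h (s j) = s i)
    (hs' : ∀ ⦃i j : J⦄ (h : i ≤ j), t h (s' j) = s' i)
    (hex : ∀ j, ∃ a ∈ A, φ j a (s j) = s' j) :
    ∃ a ∈ A, ∀ j, φ j a (s j) = s' j := by
  let F : J → Set Q := fun j => (A : Set Q) ∩ {q | φ j q (s j) = s' j}
  have hFclosed : ∀ j, IsClosed (F j) := fun j => hA.inter (isClosed_setOf_apply_eq φ hker j _ _)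
  have hFne : ∀ j, (F j).Nonempty := fun j => by
    obtain ⟨a, ha, h⟩ := hex j
    exact ⟨a, ha, h⟩
  have hFdir : Directed (· ⊇ ·) F := by
    intro i j
    obtain ⟨k, hik, hjk⟩ := exists_ge_ge i j
    refine ⟨k, ?_, ?_⟩
    · rintro q ⟨hqA, hq⟩
      refine ⟨hqA, ?_⟩
      change φ i q (s i) = s' i
      rw [← hs hik, ← hequiv hik q (s k), hq, hs' hik]
    · rintro q ⟨hqA, hq⟩
      refine ⟨hqA, ?_⟩
      change φ j q (s j) = s' j
      rw [← hs hjk, ← hequiv hjk q (s k), hq, hs' hjk]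
  obtain ⟨a, ha⟩ := IsCompact.nonempty_iInter_of_directed_nonempty_isCompact_isClosed F hFdir hFne
    (fun j => (hFclosed j).isCompact) hFclosed
  rw [Set.mem_iInter] at ha
  exact ⟨a, (ha (Classical.arbitrary J)).1, fun j => (ha j).2⟩

/-- **Levelwise translates are translates** (the case `A = Q` of
`exists_forall_apply_eq_of_forall_exists_mem`). [cite: MochizukiSemiAnbd2006, Thm 3.7(iii) p.41] -/
theorem exists_forall_apply_eq_of_forall_exists [CompactSpace Q] [IsDirectedOrder J] [Nonempty J]
    (hker : ∀ j, IsOpen ((φ j).ker : Set Q))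
    (hequiv : ∀ ⦃i j : J⦄ (h : i ≤ j) (q : Q) (x : X j), t h (φ j q x) = φ i q (t h x))
    {s s' : ∀ j, X j} (hs : ∀ ⦃i j : J⦄ (h : i ≤ j), t h (s j) = s i)
    (hs' : ∀ ⦃i j : J⦄ (h : i ≤ j), t h (s' j) = s' i)
    (hex : ∀ j, ∃ q : Q, φ j q (s j) = s' j) :
    ∃ q : Q, ∀ j, φ j q (s j) = s' j := by
  obtain ⟨a, -, ha⟩ := exists_forall_apply_eq_of_forall_exists_mem φ t hker hequiv ⊤ isClosed_univ hs hs'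
    (fun j => (hex j).imp fun q h => ⟨Subgroup.mem_top q, h⟩)
  exact ⟨a, ha⟩

omit [TopologicalSpace Q] [IsTopologicalGroup Q] [Preorder J] in
/-- **Stabilisers of translates are conjugate** (membership form): if `s' = a · s` at every level, then `q`
fixes `s'` at every level iff `a⁻¹ q a` fixes `s` at every level.
[cite: MochizukiSemiAnbd2006, Thm 3.7(iii) p.41] -/
theorem forall_apply_eq_iff_of_translate {s s' : ∀ j, X j} {a : Q} (ha : ∀ j, φ j a (s j) = s' j) (q : Q) :
    (∀ j, φ j q (s' j) = s' j) ↔ ∀ j, φ j (a⁻¹ * q * a) (s j) = s j := by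
  refine forall_congr' fun j => ?_
  have hmul : ∀ (b c : Q) (x : X j), φ j (b * c) x = φ j b (φ j c x) := fun b c x => by
    rw [map_mul]; rfl
  have hone : ∀ x : X j, φ j 1 x = x := fun x => by rw [map_one]; rfl
  rw [← ha j]
  constructor
  · intro h
    rw [hmul, hmul, h, ← hmul, inv_mul_cancel, hone]
  · intro h
    have := congrArg (φ j a) h
    rw [← hmul, show a * (a⁻¹ * q * a) = q * a by group, hmul] at this
    exact this

end CompactOrbit

end Literature.AnabelianGeometry.SemiGraphs
-- (re-land 2026-08-26T07:45Z: byte-identical content; enqueues the stranded olean build of the 05:30Z accept)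
-- (v3 2026-08-26T08:10Z: imports routed through the in-project closure (TemperedBranchPairProfinite) so the
--  build farm can install the olean; declarations byte-identical)
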